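/-
O(2) `{φ, s, t}` scan, rule (C6) on a BOX of external dimensions in ONE theorem: the closed-form channel
hypotheses of `O2ExtDiagBounds.fTable_on_dbox_of_cornerTests` for the three external channels, composed
through `O2ExtBlockTables.nodeTables_on_dbox_of_FTables` and `O2ExtFormEnclosure.extEnclosed_of_nodeTables_of_le`,
give `ExtEnclosed F D B^lo B^hi` at every `D` of the box — the binder `henc` of the box schemas.
-/
import Literature.MathematicalPhysics.QuantumFieldTheory.O2ExtDiagBounds
import HarnessLib

/-!
# O(2) `{φ, s, t}` scan: the external-form enclosure on a dimension box, end to end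

The engines lane's rule (C6) — enclosing the forms `Q_i = α_i(V⃗_ext)` of Chester et al., Algorithm 1,
uniformly on a box `lo ≤ D ≤ hi` of external dimensions — was filed in four layers:
`O2ExtFormEnclosure` (node tables of the three external channels ⇒ `ExtEnclosed`),
`O2ExtBlockTables` (head / diagonal-bound / radius / power tables ⇒ `F`-tables ⇒ node tables),
`ConformalBootstrap3D.DiagonalTailRatioBound(Wide)` (the diagonal series bound in closed form) and
`O2ExtDiagBounds` (the diagonal-bound table on a box from per-label rational corner tests).  This file is
the COMPOSITION, stated once so that a certificate reader instantiates ONE theorem per scan functional and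
per dimension box:

1. **`extEnclosed_on_dbox_of_cornerTests`** — for ONE scan functional `F` on ONE box: the box lies strictly
   above the scalar unitarity bound and avoids `Δ = 1` in each of `Δ_s, Δ_φ, Δ_t`; a common tail point
   `0 < y' < 1`, head length `N ≥ 3` and node domination `NodeDom F y' M⁺ M⁻`; per external channel
   (`0⁺`: labels `labels0p`, channel dimension `Δ_s`; `1`: `labels1`, `Δ_φ`; `2⁺`: `labels2p`, `Δ_t`) a head
   table valid on the box, the corner tests `DiagCornerTests` (finitely many rational inequalities in the
   box corners), a radius table above `tailRad` with the closed-form diagonal bounds `diagUa, diagUb`, and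
   the power corners `PowBoxTable`; finally stated bounds `B^lo, B^hi` entrywise outside the enclosure
   ASSEMBLED from these tables by the fixed row decodings (`compLo/compHi`, `nodeEncLo/nodeEncHi`,
   `extForm`) — the reader's outward rounding.  Conclusion: `ExtEnclosed F D B^lo B^hi` at every `D` of
   the box.
2. **`henc_of_dbox`** — the family version: functionals `F_k` with boxes `[lo_k, hi_k]` containing the
   region `Q`; per-box enclosures give literally the binder `henc` of
   `O2DimBoxSchema.boxExcluded_of_o2DimBoxRules`, `O2ExtFormEnclosure.boxExcluded_of_nodeTables` and
   `O2OPEScanBridge.boxExcluded_of_uniformCoverTrees`.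

NON-CLAIMS.  Soundness plumbing only: no number is evaluated, no certificate is checked, nothing is
asserted about the O(2) model; which tables make the hypotheses true for a given functional and box is the
verifier's business.  RECORD of the engines lane (PLANNING ONLY for the `O(2)` client path); no published
number is touched.

Sources.  S. M. Chester, W. Landry, J. Liu, D. Poland, D. Simmons-Duffin, N. Su, A. Vichi, *Carving out
OPE space and precise O(2) model critical exponents*, JHEP 06 (2020) 142 [arXiv:1912.03324], §3.2 (the
external vector `V⃗_ext`), §3.3 (Algorithm 1, `Q_i = α_i(V⃗_ext)`; scanning over external dimensions)
(`ChesterEtAl2020`).  F. A. Dolan, H. Osborn, *Conformal partial waves and the operator product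
expansion*, Nucl. Phys. B 678 (2004) 491, §3 eqs. (3.9)–(3.12) (the scalar-exchange recursion behind the
head / tail split) (`DolanOsborn2004`).  R. E. Moore, *Methods and Applications of Interval Analysis*,
SIAM (1979), §2.2 eqs. (2.14), (2.15), (2.19), §2.4 (endpoint formulas; outward rounding) (`Moore1979`).
-/

noncomputable section

namespace Literature.MathematicalPhysics.QuantumFieldTheory.O2ExtEnclosureDimBox

open Set
open Literature.MathematicalPhysics.QuantumFieldTheory.ConformalBootstrap3D
open O2ThreeScalarCrossing O2ThreeScalarSystem O2OPEScanBridge O2ExtFormEnclosure O2ExtBlockTables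
open O2DimBox O2ExtDiagBounds

/-- **Rule (C6) on a dimension box, end to end, for ONE scan functional.**  Hypotheses, in certificate
order: the box edges `lo.Δ_s, lo.Δ_φ, lo.Δ_t` strictly above the scalar unitarity bound and the box
avoiding `Δ = 1` in each coordinate; per channel positive tail weights `t`, the common point `0 < y' < 1`,
head length `N ≥ 3`, node domination; per channel (`0⁺` / `1` / `2⁺` with channel dimension
`Δ_s` / `Δ_φ` / `Δ_t`) a head table on the box, the rational corner tests, a radius table with the
closed-form diagonal bounds `diagUa / diagUb`, the power corners; and stated bounds `B^lo ≤` assembled lower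
enclosure, assembled upper enclosure `≤ B^hi` (the assembled tables are spelled out: they are what the
reader computes from the certificate's numbers by `fAm/fBm/fAp/fBp`, `compLo/compHi`, `nodeEncLo/nodeEncHi`
and `extForm`).  Conclusion: `ExtEnclosed F D B^lo B^hi` for every `D` of the box.
[cite: ChesterEtAl2020, §3.2 (`V⃗_ext`), §3.3 (Algorithm 1: `Q_i = α_i(V⃗_ext)`; scanning over external dimensions)]
[cite: DolanOsborn2004, §3 eqs. (3.9)–(3.12)] [cite: Moore1979, §2.2 eqs. (2.14), (2.15), (2.19), §2.4] -/
theorem extEnclosed_on_dbox_of_cornerTests (F : ScanFunctional) {lo hi : Dims} {y' : ℝ} {N : ℕ}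
    {q₀ q₁ q₂ t₀ t₁ t₂ : Label → ℝ} {Mp Mm : Fin F.M → ℝ}
    {Hlo₀ Hhi₀ Klo₀ Khi₀ Rp₀ Rm₀ P₁₀ P₂₀ Q₁₀ Q₂₀ : Fin F.M → Label → ℝ}
    {Hlo₁ Hhi₁ Klo₁ Khi₁ Rp₁ Rm₁ P₁₁ P₂₁ Q₁₁ Q₂₁ : Fin F.M → Label → ℝ}
    {Hlo₂ Hhi₂ Klo₂ Khi₂ Rp₂ Rm₂ P₁₂ P₂₂ Q₁₂ Q₂₂ : Fin F.M → Label → ℝ}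
    {Blo Bhi : Matrix (Fin 4) (Fin 4) ℝ}
    (hs : unitarityBound3D 0 < lo.Δs) (hφ : unitarityBound3D 0 < lo.Δφ)
    (hτ : unitarityBound3D 0 < lo.Δt)
    (hnes : ∀ D, InDimBox lo hi D → D.Δs ≠ 1) (hneφ : ∀ D, InDimBox lo hi D → D.Δφ ≠ 1)
    (hnet : ∀ D, InDimBox lo hi D → D.Δt ≠ 1)
    (ht₀ : ∀ L, 0 < t₀ L) (ht₁ : ∀ L, 0 < t₁ L) (ht₂ : ∀ L, 0 < t₂ L)
    (hy0 : 0 < y') (hy1 : y' < 1) (hN : 3 ≤ N) (hdom : NodeDom F y' Mp Mm)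
    (hH₀ : ∀ D, InDimBox lo hi D → HeadTable F D labels0p D.Δs N Hlo₀ Hhi₀ Klo₀ Khi₀)
    (hH₁ : ∀ D, InDimBox lo hi D → HeadTable F D labels1 D.Δφ N Hlo₁ Hhi₁ Klo₁ Khi₁)
    (hH₂ : ∀ D, InDimBox lo hi D → HeadTable F D labels2p D.Δt N Hlo₂ Hhi₂ Klo₂ Khi₂)
    (hT₀ : DiagCornerTests lo hi labels0p lo.Δs hi.Δs y' N q₀)
    (hT₁ : DiagCornerTests lo hi labels1 lo.Δφ hi.Δφ y' N q₁)
    (hT₂ : DiagCornerTests lo hi labels2p lo.Δt hi.Δt y' N q₂)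
    (hR₀ : ∀ D, InDimBox lo hi D → RadTable F D labels0p D.Δs N y' t₀
      (diagUa lo hi lo.Δs hi.Δs N q₀ y') (diagUb lo hi lo.Δs hi.Δs N q₀ y') Mp Mm Rp₀ Rm₀)
    (hR₁ : ∀ D, InDimBox lo hi D → RadTable F D labels1 D.Δφ N y' t₁
      (diagUa lo hi lo.Δφ hi.Δφ N q₁ y') (diagUb lo hi lo.Δφ hi.Δφ N q₁ y') Mp Mm Rp₁ Rm₁)
    (hR₂ : ∀ D, InDimBox lo hi D → RadTable F D labels2p D.Δt N y' t₂
      (diagUa lo hi lo.Δt hi.Δt N q₂ y') (diagUb lo hi lo.Δt hi.Δt N q₂ y') Mp Mm Rp₂ Rm₂)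
    (hP₀ : PowBoxTable F lo hi labels0p P₁₀ P₂₀ Q₁₀ Q₂₀)
    (hP₁ : PowBoxTable F lo hi labels1 P₁₁ P₂₁ Q₁₁ Q₂₁)
    (hP₂ : PowBoxTable F lo hi labels2p P₁₂ P₂₂ Q₁₂ Q₂₂)
    (hlo : ∀ i k, Blo i k ≤ extForm
      (nodeEncLo F
        (compLo coefM0p coefP0p rowLab0p
          (fAm P₁₀ P₂₀ Q₁₀ Q₂₀ (fun m L => Hlo₀ m L - Rp₀ m L) (fun m L => Khi₀ m L + Rm₀ m L))
          (fBm P₁₀ P₂₀ Q₁₀ Q₂₀ (fun m L => Hhi₀ m L + Rp₀ m L) (fun m L => Klo₀ m L - Rm₀ m L))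
          (fAp P₁₀ P₂₀ Q₁₀ Q₂₀ (fun m L => Hlo₀ m L - Rp₀ m L) (fun m L => Klo₀ m L - Rm₀ m L))
          (fBp P₁₀ P₂₀ Q₁₀ Q₂₀ (fun m L => Hhi₀ m L + Rp₀ m L) (fun m L => Khi₀ m L + Rm₀ m L)))
        (compHi coefM0p coefP0p rowLab0p
          (fAm P₁₀ P₂₀ Q₁₀ Q₂₀ (fun m L => Hlo₀ m L - Rp₀ m L) (fun m L => Khi₀ m L + Rm₀ m L))
          (fBm P₁₀ P₂₀ Q₁₀ Q₂₀ (fun m L => Hhi₀ m L + Rp₀ m L) (fun m L => Klo₀ m L - Rm₀ m L))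
          (fAp P₁₀ P₂₀ Q₁₀ Q₂₀ (fun m L => Hlo₀ m L - Rp₀ m L) (fun m L => Klo₀ m L - Rm₀ m L))
          (fBp P₁₀ P₂₀ Q₁₀ Q₂₀ (fun m L => Hhi₀ m L + Rp₀ m L) (fun m L => Khi₀ m L + Rm₀ m L))))
      (nodeEncLo F
        (compLo coefM1 coefP1 rowLab1
          (fAm P₁₁ P₂₁ Q₁₁ Q₂₁ (fun m L => Hlo₁ m L - Rp₁ m L) (fun m L => Khi₁ m L + Rm₁ m L))
          (fBm P₁₁ P₂₁ Q₁₁ Q₂₁ (fun m L => Hhi₁ m L + Rp₁ m L) (fun m L => Klo₁ m L - Rm₁ m L))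
          (fAp P₁₁ P₂₁ Q₁₁ Q₂₁ (fun m L => Hlo₁ m L - Rp₁ m L) (fun m L => Klo₁ m L - Rm₁ m L))
          (fBp P₁₁ P₂₁ Q₁₁ Q₂₁ (fun m L => Hhi₁ m L + Rp₁ m L) (fun m L => Khi₁ m L + Rm₁ m L)))
        (compHi coefM1 coefP1 rowLab1
          (fAm P₁₁ P₂₁ Q₁₁ Q₂₁ (fun m L => Hlo₁ m L - Rp₁ m L) (fun m L => Khi₁ m L + Rm₁ m L))
          (fBm P₁₁ P₂₁ Q₁₁ Q₂₁ (fun m L => Hhi₁ m L + Rp₁ m L) (fun m L => Klo₁ m L - Rm₁ m L))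
          (fAp P₁₁ P₂₁ Q₁₁ Q₂₁ (fun m L => Hlo₁ m L - Rp₁ m L) (fun m L => Klo₁ m L - Rm₁ m L))
          (fBp P₁₁ P₂₁ Q₁₁ Q₂₁ (fun m L => Hhi₁ m L + Rp₁ m L) (fun m L => Khi₁ m L + Rm₁ m L))))
      (nodeEncLo F
        (compLo coefM2p coefP2p rowLab2p
          (fAm P₁₂ P₂₂ Q₁₂ Q₂₂ (fun m L => Hlo₂ m L - Rp₂ m L) (fun m L => Khi₂ m L + Rm₂ m L))
          (fBm P₁₂ P₂₂ Q₁₂ Q₂₂ (fun m L => Hhi₂ m L + Rp₂ m L) (fun m L => Klo₂ m L - Rm₂ m L))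
          (fAp P₁₂ P₂₂ Q₁₂ Q₂₂ (fun m L => Hlo₂ m L - Rp₂ m L) (fun m L => Klo₂ m L - Rm₂ m L))
          (fBp P₁₂ P₂₂ Q₁₂ Q₂₂ (fun m L => Hhi₂ m L + Rp₂ m L) (fun m L => Khi₂ m L + Rm₂ m L)))
        (compHi coefM2p coefP2p rowLab2p
          (fAm P₁₂ P₂₂ Q₁₂ Q₂₂ (fun m L => Hlo₂ m L - Rp₂ m L) (fun m L => Khi₂ m L + Rm₂ m L))
          (fBm P₁₂ P₂₂ Q₁₂ Q₂₂ (fun m L => Hhi₂ m L + Rp₂ m L) (fun m L => Klo₂ m L - Rm₂ m L))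
          (fAp P₁₂ P₂₂ Q₁₂ Q₂₂ (fun m L => Hlo₂ m L - Rp₂ m L) (fun m L => Klo₂ m L - Rm₂ m L))
          (fBp P₁₂ P₂₂ Q₁₂ Q₂₂ (fun m L => Hhi₂ m L + Rp₂ m L) (fun m L => Khi₂ m L + Rm₂ m L)))) i k)
    (hhi : ∀ i k, extForm
      (nodeEncHi F
        (compLo coefM0p coefP0p rowLab0p
          (fAm P₁₀ P₂₀ Q₁₀ Q₂₀ (fun m L => Hlo₀ m L - Rp₀ m L) (fun m L => Khi₀ m L + Rm₀ m L))
          (fBm P₁₀ P₂₀ Q₁₀ Q₂₀ (fun m L => Hhi₀ m L + Rp₀ m L) (fun m L => Klo₀ m L - Rm₀ m L))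
          (fAp P₁₀ P₂₀ Q₁₀ Q₂₀ (fun m L => Hlo₀ m L - Rp₀ m L) (fun m L => Klo₀ m L - Rm₀ m L))
          (fBp P₁₀ P₂₀ Q₁₀ Q₂₀ (fun m L => Hhi₀ m L + Rp₀ m L) (fun m L => Khi₀ m L + Rm₀ m L)))
        (compHi coefM0p coefP0p rowLab0p
          (fAm P₁₀ P₂₀ Q₁₀ Q₂₀ (fun m L => Hlo₀ m L - Rp₀ m L) (fun m L => Khi₀ m L + Rm₀ m L))
          (fBm P₁₀ P₂₀ Q₁₀ Q₂₀ (fun m L => Hhi₀ m L + Rp₀ m L) (fun m L => Klo₀ m L - Rm₀ m L))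
          (fAp P₁₀ P₂₀ Q₁₀ Q₂₀ (fun m L => Hlo₀ m L - Rp₀ m L) (fun m L => Klo₀ m L - Rm₀ m L))
          (fBp P₁₀ P₂₀ Q₁₀ Q₂₀ (fun m L => Hhi₀ m L + Rp₀ m L) (fun m L => Khi₀ m L + Rm₀ m L))))
      (nodeEncHi F
        (compLo coefM1 coefP1 rowLab1
          (fAm P₁₁ P₂₁ Q₁₁ Q₂₁ (fun m L => Hlo₁ m L - Rp₁ m L) (fun m L => Khi₁ m L + Rm₁ m L))
          (fBm P₁₁ P₂₁ Q₁₁ Q₂₁ (fun m L => Hhi₁ m L + Rp₁ m L) (fun m L => Klo₁ m L - Rm₁ m L))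
          (fAp P₁₁ P₂₁ Q₁₁ Q₂₁ (fun m L => Hlo₁ m L - Rp₁ m L) (fun m L => Klo₁ m L - Rm₁ m L))
          (fBp P₁₁ P₂₁ Q₁₁ Q₂₁ (fun m L => Hhi₁ m L + Rp₁ m L) (fun m L => Khi₁ m L + Rm₁ m L)))
        (compHi coefM1 coefP1 rowLab1
          (fAm P₁₁ P₂₁ Q₁₁ Q₂₁ (fun m L => Hlo₁ m L - Rp₁ m L) (fun m L => Khi₁ m L + Rm₁ m L))
          (fBm P₁₁ P₂₁ Q₁₁ Q₂₁ (fun m L => Hhi₁ m L + Rp₁ m L) (fun m L => Klo₁ m L - Rm₁ m L))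
          (fAp P₁₁ P₂₁ Q₁₁ Q₂₁ (fun m L => Hlo₁ m L - Rp₁ m L) (fun m L => Klo₁ m L - Rm₁ m L))
          (fBp P₁₁ P₂₁ Q₁₁ Q₂₁ (fun m L => Hhi₁ m L + Rp₁ m L) (fun m L => Khi₁ m L + Rm₁ m L))))
      (nodeEncHi F
        (compLo coefM2p coefP2p rowLab2p
          (fAm P₁₂ P₂₂ Q₁₂ Q₂₂ (fun m L => Hlo₂ m L - Rp₂ m L) (fun m L => Khi₂ m L + Rm₂ m L))
          (fBm P₁₂ P₂₂ Q₁₂ Q₂₂ (fun m L => Hhi₂ m L + Rp₂ m L) (fun m L => Klo₂ m L - Rm₂ m L))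
          (fAp P₁₂ P₂₂ Q₁₂ Q₂₂ (fun m L => Hlo₂ m L - Rp₂ m L) (fun m L => Klo₂ m L - Rm₂ m L))
          (fBp P₁₂ P₂₂ Q₁₂ Q₂₂ (fun m L => Hhi₂ m L + Rp₂ m L) (fun m L => Khi₂ m L + Rm₂ m L)))
        (compHi coefM2p coefP2p rowLab2p
          (fAm P₁₂ P₂₂ Q₁₂ Q₂₂ (fun m L => Hlo₂ m L - Rp₂ m L) (fun m L => Khi₂ m L + Rm₂ m L))
          (fBm P₁₂ P₂₂ Q₁₂ Q₂₂ (fun m L => Hhi₂ m L + Rp₂ m L) (fun m L => Klo₂ m L - Rm₂ m L))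
          (fAp P₁₂ P₂₂ Q₁₂ Q₂₂ (fun m L => Hlo₂ m L - Rp₂ m L) (fun m L => Klo₂ m L - Rm₂ m L))
          (fBp P₁₂ P₂₂ Q₁₂ Q₂₂ (fun m L => Hhi₂ m L + Rp₂ m L) (fun m L => Khi₂ m L + Rm₂ m L)))) i k
      ≤ Bhi i k) :
    ∀ D, InDimBox lo hi D → ExtEnclosed F.toFunctional D Blo Bhi := by
  obtain ⟨n0, n1, n2⟩ := nodeTables_on_dbox_of_FTables F
    (fTable_on_dbox_of_cornerTests F (Δc := fun D => D.Δs) hs (fun D hD => hD.1) hnes ht₀ hy0 hy1 hN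
      hdom hH₀ hT₀ hR₀ hP₀)
    (fTable_on_dbox_of_cornerTests F (Δc := fun D => D.Δφ) hφ (fun D hD => hD.2.1) hneφ ht₁ hy0 hy1 hN
      hdom hH₁ hT₁ hR₁ hP₁)
    (fTable_on_dbox_of_cornerTests F (Δc := fun D => D.Δt) hτ (fun D hD => hD.2.2) hnet ht₂ hy0 hy1 hN
      hdom hH₂ hT₂ hR₂ hP₂)
  exact fun D hD => extEnclosed_of_nodeTables_of_le F D (n0 D hD) (n1 D hD) (n2 D hD) hlo hhi

/-- **The binder `henc` of the box schemas from per-box enclosures.**  Functionals `F_k`, each with an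
enclosure of its external forms valid on its whole box `[lo_k, hi_k]` (e.g. from
`extEnclosed_on_dbox_of_cornerTests`), and a region `Q` inside all the boxes: then at every point of `Q`
every `F_k` is enclosed — literally the hypothesis `henc` of `O2DimBoxSchema.boxExcluded_of_o2DimBoxRules`,
`O2ExtFormEnclosure.boxExcluded_of_nodeTables` and `O2OPEScanBridge.boxExcluded_of_uniformCoverTrees`.
[cite: ChesterEtAl2020, §3.3 (Algorithm 1; scanning over external dimensions: allowed and disallowed points)] -/
theorem henc_of_dbox {Q : Set (ℝ × ℝ × ℝ)} {ι : Type*} (F : ι → ScanFunctional) (lo hi : ι → Dims)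
    (Blo Bhi : ι → Matrix (Fin 4) (Fin 4) ℝ)
    (hQ : ∀ D : Dims, (D.Δs, D.Δφ, D.Δt) ∈ Q → ∀ k, InDimBox (lo k) (hi k) D)
    (hk : ∀ k D, InDimBox (lo k) (hi k) D → ExtEnclosed (F k).toFunctional D (Blo k) (Bhi k)) :
    ∀ D : Dims, (D.Δs, D.Δφ, D.Δt) ∈ Q → ∀ k, ExtEnclosed (F k).toFunctional D (Blo k) (Bhi k) :=
  fun D hD k => hk k D (hQ D hD k)

end Literature.MathematicalPhysics.QuantumFieldTheory.O2ExtEnclosureDimBox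

end
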